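import Summits.AtomisticToContinuum.HydrodynamicLimit.Theses.AnnealedZeroHorizon

/-!
# Route AnnealedZeroHorizon — `SpreadBoundsClassicalTime` (item stmt-AtomisticToContinuum-9261)

Glue (pure quantifier bookkeeping). Under `HydrodynamicLimitFor σ`, an `O(1)` realisation spread
of the empirical momentum field `⟨m_N(t), χ⟩` at a fixed macroscopic time `t ≥ 0` — probability
`≥ δ` of deviating by more than `δ` from EVERY deterministic centring `c : ℕ → V3`, frequently in
`N` — bounds the classical existence time of any hard-sphere Euler solution `(ρ, u, θ)` on `[0, T)`
launched from the same local-Gibbs data along the same flow family: `T ≤ t`.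

Proof: if `t < T` then `t ∈ [0, T)`, so `HydrodynamicLimitFor σ` gives convergence in probability
of the fields at time `t`; its momentum component says that, for the constant centring
`c_N := ∫ χ ρ(t) u(t)`, the probability of a `δ`-deviation tends to `0`, hence is eventually
`< δ`, contradicting the spread hypothesis at that centring.

Main result: `spreadBoundsClassicalTime_proof : …Theses.AnnealedZeroHorizon.SpreadBoundsClassicalTime`.
-/

namespace Summit.AtomisticToContinuum.HydrodynamicLimit.Theorems

open Filter MeasureTheory Set
open Literature.MathematicalPhysics.KineticTheory

/-- **Spread bounds the classical time** (route AnnealedZeroHorizon, support item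
stmt-AtomisticToContinuum-9261): if `HydrodynamicLimitFor σ` holds and, for continuous positive
local-Gibbs profiles, a flow family `Φ`, a time `t ≥ 0`, a continuous `χ` and `δ > 0`, the local
Gibbs law gives probability `≥ δ` to `{‖⟨m_N(t), χ⟩ − c_N‖ > δ}` frequently in `N` for every
centring `c`, then every classical hs-Euler solution on `[0, T)` whose time-`0` fields are the
local-Gibbs limit along `Φ` has `T ≤ t`. -/
theorem spreadBoundsClassicalTime_proof :
    Summit.AtomisticToContinuum.HydrodynamicLimit.Theses.AnnealedZeroHorizon.SpreadBoundsClassicalTime := by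
  unfold Summit.AtomisticToContinuum.HydrodynamicLimit.Theses.AnnealedZeroHorizon.SpreadBoundsClassicalTime
  intro σ hHL a₀ θ₀ u₀ ha hθ hu ha0 hθ0 t χ δ ht hχ hδ Φ hspread T ρ θ u hE h0
  refine not_lt.mp fun hTt => ?_
  -- `t ∈ [0, T)`: the hydrodynamic limit applies at time `t`.
  obtain ⟨-, hmom, -⟩ := hHL a₀ θ₀ u₀ ha hθ hu ha0 hθ0 T ρ θ u hE Φ h0 t ⟨ht, hTt⟩ χ hχ δ hδ
  -- Constant centring: the classical momentum moment `∫ χ ρ(t) u(t)`.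
  have hfreq := hspread fun _ => ∫ x, (χ x * ρ t x) • u t x
  have hev := hmom.eventually_lt_const (ENNReal.ofReal_pos.mpr hδ)
  obtain ⟨N, hN⟩ := (hfreq.and_eventually hev).exists
  exact (not_lt.mpr hN.1) hN.2

end Summit.AtomisticToContinuum.HydrodynamicLimit.Theorems
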